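import Summits.PneNP.PneNP.Theorems.SoloBlindConsistentStreaming
import Literature.Computability.Complexity.CodeFPArith
import Literature.Computability.QuantumComplexity.AnnotatedPairCountsPSpace
import Literature.Barriers.QuantumAdvantage.TQBFSavitchCode
import HarnessLib

/-!
# Fact-free uniform magnification for `MCSP[s]`, Layer 2: the consistent-program update on codes

(Solo seat `solo-PneNP-blind`; companion of `SoloBlindConsistentStreaming.lean`.)

Layer 1 built the one-pass streaming algorithm `CStream.alg s sel` for `MCSP[s]` that keeps ONE
evaluator program consistent with the prefix read so far, over an abstract selector `sel`, and
proved it correct (`alg_decides`) and small-space (`alg_runsInSpace`). This file shows that every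
map the algorithm's machines must compute is polynomial-time ON CODES, in the tree's typed
`CodeFP` algebra (`CodeFP.lean`, `CodeFPArith.lean`), uniformly in a PADDING parameter `P`
(a unary budget `1^P` carried in the input word; the update machine of Layer 3 supplies `P = N`
by a counting loop, which is what makes the per-bit cost polynomial in `N` rather than in the
length of the short state):

* `GoodP s P N j D b D'` — the goodness test of Layer 1 with its row loop run over
  `t < min j P` (`goodP_self : GoodP s N N … = Good s N …`), computed on codes from a
  code-computation `CodeFP unE natE s` of the size bound on unary inputs (`cf_goodP`);
* the state decoders and encoder (`cf_decJ`, `cf_decA`, `cf_decD`, `cf_encSt`, `cf_parse`);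
* the padded update `updateP s g P N σ b`, whose selector is an arbitrary string function
  `g ∈ FP` run on the padded instance `⟨1^P, bin N, bin j, D, b⟩`
  (`cf_updateP`; `updateP_self : updateP s g N N = update s (selN g) N`);
* the accepting predicate (`cf_accept`) and the three stages of the padding loop
  (`cf_padInit`, `cf_padStep`, `cf_padCore`).

No complexity-theoretic hypothesis enters here. Layer 3 turns these code-computations into
explicit-time `TM2` machines; Layer 4 chooses `g` by search-to-decision under `NP ⊆ P`.

References: S. Arora, B. Barak, *Computational Complexity: A Modern Approach* (2009), §1.3,
§2.1 [bib: AroraBarak2009]; D. M. McKay, C. D. Murray, R. R. Williams, STOC 2019,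
doi:10.1145/3313276.3316396, §5 [bib: McKayMurrayWilliams2019].
-/

namespace Summit.PneNP.PneNP.Theorems.SoloBlind

open Computability
open Literature.Computability.Complexity Literature.Computability.Complexity.CircEval
open Literature.Computability.Complexity.CodeFP (natE unE bitE pairE rawE strE unitE pairE_apply
  unE_eq_ones length_unE)
open Literature.Computability.MetaComplexity Literature.Computability.MetaComplexity.MCSPVerif
open Literature.Computability.MetaComplexity.McKayMurrayWilliams2019

namespace CStream

variable (s : ℕ → ℕ)

/-! ### Plumbing on codes -/

/-- Unary predecessor. [folklore] -/
theorem cf_unPred : CodeFP unE unE (fun k => k - 1) :=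
  (CodeFP.strDrop.comp ((CodeFP.const unE 1).pair CodeFP.strOfUn)).recodeOut fun k => by
    cases k <;> rfl

/-- `bin N ↦ 1^{⌊log₂ N⌋}`. [folklore] -/
theorem cf_log : CodeFP natE unE (fun N => Nat.log 2 N) :=
  (cf_unPred.comp (CodeFP.strLength.comp CodeFP.strOfNat)).congr fun N => by
    show (natE N).length - 1 = Nat.log 2 N
    rw [show (natE N).length = N.size from TM2Pass.length_encodeNat_eq_size N]
    rcases Nat.eq_zero_or_pos N with rfl | hN
    · simp
    · have h1 : Nat.log 2 N < Nat.size N := Nat.lt_size.2 (Nat.pow_log_le_self 2 hN.ne')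
      have h2 : Nat.size N ≤ Nat.log 2 N + 1 :=
        Nat.size_le.2 (Nat.lt_pow_succ_log_self one_lt_two N)
      omega

/-- The padded row: the bits of `t`, least significant first, to length `n`. [folklore] -/
theorem ofFn_lowBits_eq (n t : ℕ) :
    List.ofFn (lowBits n t) = (encodeNat t ++ List.replicate n false).take n := by
  apply List.ext_getElem
  · simp
  · intro k h1 h2
    rw [List.length_ofFn] at h1
    simp only [List.getElem_ofFn, lowBits, List.getElem_take]
    rcases lt_or_ge k (encodeNat t).length with hk | hk
    · rw [List.getElem_append_left hk, List.getD_eq_getElem _ _ hk]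
    · rw [List.getElem_append_right hk, List.getElem_replicate, List.getD_eq_default _ _ hk]

/-- Rows on codes: `(1ⁿ, bin t) ↦ List.ofFn (lowBits n t)`. [folklore] -/
theorem cf_row : CodeFP (pairE unE natE) strE (fun p => List.ofFn (lowBits p.1 p.2)) :=
  (CodeFP.strTake.comp ((CodeFP.fst _ _).pair (CodeFP.strAppend.comp
    ((CodeFP.strOfNat.comp (CodeFP.snd _ _)).pair
      (Literature.Barriers.QuantumAdvantage.TQBFRed.strZeros.comp (CodeFP.fst _ _)))))).congr
    fun p => by
      show (natE p.2 ++ List.replicate p.1 false).take p.1 = List.ofFn (lowBits p.1 p.2)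
      exact (ofFn_lowBits_eq p.1 p.2).symm

/-- The evaluator's answer bit on codes: `(1ⁿ, D, bin t) ↦ ev n D t`.
[cite: AroraBarak2009, Rem. 6.4] -/
theorem cf_ev : CodeFP (pairE unE (pairE strE natE)) bitE (fun p => ev p.1 p.2.1 p.2.2) := by
  have hE : CodeFP strE strE evalFn := CodeFP.of_fn evalFn evalFn_mem_FP fun _ => rfl
  have hIn : CodeFP (pairE unE (pairE strE natE)) strE
      (fun p => boolPair (List.ofFn (lowBits p.1 p.2.2)) p.2.1) :=
    ((cf_row.comp ((CodeFP.fst _ _).pair (CodeFP.snd _ _).snd')).pair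
      (CodeFP.snd _ _).fst').recodeOut fun _ => rfl
  exact (hE.comp hIn).recodeOut fun p => by
    show evalFn (boolPair (List.ofFn (lowBits p.1 p.2.2)) p.2.1) = [ev p.1 p.2.1 p.2.2]
    rw [ev, evalFn_boolPair]
    rfl

variable {s} in
/-- Admissibility on codes, from a code-computation of `s` on unary inputs. [folklore] -/
theorem cf_adm (hsC : CodeFP unE natE s) :
    CodeFP (pairE unE strE) bitE (fun p => Adm s p.1 p.2) := by
  have hClean : CodeFP strE bitE isClean :=
    CodeFP.of_fn cleanT.eval cleanT_mem_FP fun D => by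
      show cleanT.eval D = [isClean D]
      exact cleanT_eval D
  have hTab : CodeFP strE unE tabCount :=
    CodeFP.of_fn tabMarksT.eval tabMarksT_mem_FP fun D => by
      show tabMarksT.eval D = unE (tabCount D)
      rw [tabMarksT_eval, unE_eq_ones]
  have hS : CodeFP (pairE unE strE) natE (fun p => s p.1) := hsC.comp (CodeFP.fst _ _)
  have hN : CodeFP (pairE unE strE) natE (fun p => p.1) :=
    (CodeFP.natOfUn.comp (CodeFP.fst _ _)).congr fun _ => rfl
  have hK : CodeFP (pairE unE strE) natE (fun p => K s p.1) :=
    (CodeFP.natMul.comp ((CodeFP.natAdd.comp (hS.pair (CodeFP.const _ 1))).pair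
      (CodeFP.natAdd.comp ((CodeFP.natMul.comp ((CodeFP.const _ 8).pair
        (CodeFP.natAdd.comp (hN.pair hS)))).pair (CodeFP.const _ 10))))).congr fun _ => rfl
  have h1 : CodeFP (pairE unE strE) bitE (fun p => isClean p.2) := hClean.comp (CodeFP.snd _ _)
  have h2 : CodeFP (pairE unE strE) bitE (fun p => decide (tabCount p.2 ≤ s p.1)) :=
    CodeFP.unLeNat.comp ((hTab.comp (CodeFP.snd _ _)).pair hS)
  have h3 : CodeFP (pairE unE strE) bitE (fun p => decide (1 ≤ s p.1)) :=
    CodeFP.natLe.comp ((CodeFP.const _ 1).pair hS)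
  have h4 : CodeFP (pairE unE strE) bitE (fun p => decide (p.2.length ≤ K s p.1)) :=
    CodeFP.unLeNat.comp ((CodeFP.strLength.comp (CodeFP.snd _ _)).pair hK)
  exact (((h1.and h2).and h3).and h4).congr fun _ => rfl

/-! ### The padded goodness test -/

/-- Padded instances `⟨1^P, bin N, bin j, D, b⟩` of the successor-program search. [folklore] -/
abbrev Inst : Type := ℕ × ℕ × ℕ × List Bool × Bool

/-- The code of a padded instance. [folklore] -/
abbrev instE : Inst → List Bool := pairE unE (pairE natE (pairE natE (pairE strE bitE)))

/-- The goodness test with its row loop run over `t < min j P`. [folklore] -/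
def GoodP (P N j : ℕ) (D : List Bool) (b : Bool) (D' : List Bool) : Bool :=
  Adm s (Nat.log 2 N) D' &&
    ((List.range (min j P)).all fun t => ev (Nat.log 2 N) D' t == ev (Nat.log 2 N) D t) &&
      (ev (Nat.log 2 N) D' j == b)

/-- At `P = N` the padded test is the test of Layer 1. [folklore] -/
theorem goodP_self (N j : ℕ) (D : List Bool) (b : Bool) (D' : List Bool) :
    GoodP s N N j D b D' = Good s N j D b D' := by
  rw [Bool.eq_iff_iff, good_iff]
  simp only [GoodP, Bool.and_eq_true, List.all_eq_true, List.mem_range, lt_min_iff, beq_iff_eq]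
  exact ⟨fun ⟨⟨h1, h2⟩, h3⟩ => ⟨h1, fun t htj htN => h2 t ⟨htj, htN⟩, h3⟩,
    fun ⟨h1, h2, h3⟩ => ⟨⟨h1, fun t ht => h2 t ht.1 ht.2⟩, h3⟩⟩

variable {s} in
/-- **The padded goodness test is computed on codes.** [cite: AroraBarak2009, §1.3] -/
theorem cf_goodP (hsC : CodeFP unE natE s) :
    CodeFP (pairE instE strE) bitE
      (fun q => GoodP s q.1.1 q.1.2.1 q.1.2.2.1 q.1.2.2.2.1 q.1.2.2.2.2 q.2) := by
  have hP : CodeFP (pairE instE strE) unE (fun q => q.1.1) := (CodeFP.fst _ _).fst'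
  have hN : CodeFP (pairE instE strE) natE (fun q => q.1.2.1) := (CodeFP.fst _ _).snd'.fst'
  have hj : CodeFP (pairE instE strE) natE (fun q => q.1.2.2.1) := (CodeFP.fst _ _).snd'.snd'.fst'
  have hD : CodeFP (pairE instE strE) strE (fun q => q.1.2.2.2.1) :=
    (CodeFP.fst _ _).snd'.snd'.snd'.fst'
  have hb : CodeFP (pairE instE strE) bitE (fun q => q.1.2.2.2.2) :=
    (CodeFP.fst _ _).snd'.snd'.snd'.snd'
  have hD' : CodeFP (pairE instE strE) strE (fun q => q.2) := CodeFP.snd _ _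
  have hn : CodeFP (pairE instE strE) unE (fun q => Nat.log 2 q.1.2.1) := cf_log.comp hN
  have c1 : CodeFP (pairE instE strE) bitE (fun q => Adm s (Nat.log 2 q.1.2.1) q.2) :=
    (cf_adm hsC).comp (hn.pair hD')
  have hL : CodeFP (pairE instE strE) (rawE natE) (fun q => List.range (min q.1.2.2.1 q.1.1)) :=
    ((CodeFP.brange unitE).comp ((CodeFP.replicateUnit.comp hP).pair hj)).congr fun q => by
      simp
  have hEq : CodeFP (pairE (pairE unE (pairE strE strE)) natE) bitE
      (fun r => ev r.1.1 r.1.2.1 r.2 == ev r.1.1 r.1.2.2 r.2) :=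
    (CodeFP.beq CodeFP.bitE_injective).comp
      ((cf_ev.comp ((CodeFP.fst _ _).fst'.pair (((CodeFP.fst _ _).snd'.fst').pair
          (CodeFP.snd _ _)))).pair
        (cf_ev.comp ((CodeFP.fst _ _).fst'.pair (((CodeFP.fst _ _).snd'.snd').pair
          (CodeFP.snd _ _)))))
  have c2 : CodeFP (pairE instE strE) bitE
      (fun q => (List.range (min q.1.2.2.1 q.1.1)).all fun t =>
        ev (Nat.log 2 q.1.2.1) q.2 t == ev (Nat.log 2 q.1.2.1) q.1.2.2.2.1 t) :=
    (CodeFP.all hEq).comp ((hn.pair (hD'.pair hD)).pair hL)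
  have c3 : CodeFP (pairE instE strE) bitE
      (fun q => ev (Nat.log 2 q.1.2.1) q.2 q.1.2.2.1 == q.1.2.2.2.2) :=
    (CodeFP.beq CodeFP.bitE_injective).comp ((cf_ev.comp (hn.pair (hD'.pair hj))).pair hb)
  exact ((c1.and c2).and c3).congr fun _ => rfl

/-! ### States on codes -/

/-- Emptiness test. [folklore] -/
theorem cf_isNil : CodeFP strE bitE (fun σ : List Bool => decide (σ = [])) :=
  CodeFP.of_fn Brick.isNilFn Brick.isNilFn_mem_FP fun _ => rfl

/-- The row counter on codes. [folklore] -/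
theorem cf_decJ : CodeFP strE natE decJ :=
  (CodeFP.strVal.comp Literature.Computability.QuantumComplexity.ADH.PCSpec.fstP_code).congr
    fun _ => rfl

/-- The liveness bit on codes. [folklore] -/
theorem cf_decA : CodeFP strE bitE decA :=
  (CodeFP.strTake.comp ((CodeFP.const strE 1).pair
    (CodeFP.strAppend.comp (Literature.Computability.QuantumComplexity.ADH.PCSpec.sndP_code.pair
      (CodeFP.const strE [false]))))).recodeOut fun σ => by
    show (sndP σ ++ [false]).take 1 = [(sndP σ).headD false]
    cases sndP σ <;> rfl

/-- The program on codes. [folklore] -/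
theorem cf_decD : CodeFP strE strE decD :=
  (CodeFP.strDrop.comp ((CodeFP.const strE 1).pair
    Literature.Computability.QuantumComplexity.ADH.PCSpec.sndP_code)).congr fun σ => by
    show (sndP σ).drop 1 = (sndP σ).tail
    cases sndP σ <;> rfl

/-- The state encoder on codes. [folklore] -/
theorem cf_encSt : CodeFP (pairE natE (pairE bitE strE)) strE (fun p => encSt p.1 p.2.1 p.2.2) := by
  have hbit : CodeFP (pairE natE (pairE bitE strE)) strE (fun p => [p.2.1]) :=
    ((CodeFP.snd _ _).fst').recodeOut fun _ => rfl
  have h : CodeFP (pairE natE (pairE bitE strE)) (pairE natE strE)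
      (fun p => (p.1, p.2.1 :: p.2.2)) :=
    ((CodeFP.fst _ _).pair (CodeFP.strAppend.comp (hbit.pair (CodeFP.snd _ _).snd'))).congr
      fun _ => rfl
  exact h.recodeOut fun _ => rfl

/-- Parsing a state: the empty (initial) state reads as `(0, alive, [])`. [folklore] -/
def parse (σ : List Bool) : ℕ × Bool × List Bool :=
  if σ = [] then (0, true, []) else (decJ σ, decA σ, decD σ)

/-- Parsing on codes. [folklore] -/
theorem cf_parse : CodeFP strE (pairE natE (pairE bitE strE)) parse :=
  (cf_isNil.ite (CodeFP.const _ ((0 : ℕ), true, ([] : List Bool)))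
    (cf_decJ.pair (cf_decA.pair cf_decD))).congr fun σ => by
    by_cases h : σ = [] <;> simp [parse, h]

/-! ### The padded update -/

/-- The selector induced by a string function `g` on padded instances. [folklore] -/
def selOf (g : List Bool → List Bool) (P N j : ℕ) (D : List Bool) (b : Bool) : List Bool :=
  g (instE (P, N, j, D, b))

/-- The selector at padding `P = N`. [folklore] -/
def selN (g : List Bool → List Bool) : Sel := fun N j D b => selOf g N N j D b

/-- The padded step. [folklore] -/
def stepP (g : List Bool → List Bool) (P N : ℕ) (st : ℕ × Bool × List Bool) (b : Bool) :
    ℕ × Bool × List Bool :=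
  if (st.2.1 && GoodP s P N st.1 st.2.2 b (selOf g P N st.1 st.2.2 b)) = true then
    (st.1 + 1, true, selOf g P N st.1 st.2.2 b)
  else (st.1 + 1, false, [])

/-- At `P = N` the padded step is the step of Layer 1 with selector `selN g`. [folklore] -/
theorem stepP_self (g : List Bool → List Bool) (N : ℕ) (st : ℕ × Bool × List Bool) (b : Bool) :
    stepP s g N N st b = stepA s (selN g) N st b := by
  unfold stepP stepA selN
  rw [goodP_self]
  simp only [Bool.and_eq_true]

/-- The padded update on a parsed state. [folklore] -/
def nextP (g : List Bool → List Bool) (P N j : ℕ) (a : Bool) (D : List Bool) (b : Bool) :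
    List Bool :=
  encSt (stepP s g P N (j, a, D) b).1 (stepP s g P N (j, a, D) b).2.1
    (stepP s g P N (j, a, D) b).2.2

/-- **The padded update map.** [folklore] -/
def updateP (g : List Bool → List Bool) (P N : ℕ) (σ : List Bool) (b : Bool) : List Bool :=
  nextP s g P N (parse σ).1 (parse σ).2.1 (parse σ).2.2 b

/-- At `P = N` the padded update is the update of Layer 1 with selector `selN g`. [folklore] -/
theorem updateP_self (g : List Bool → List Bool) (N : ℕ) (σ : List Bool) (b : Bool) :
    updateP s g N N σ b = update s (selN g) N σ b := by
  unfold updateP update parse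
  split_ifs with h <;> simp [nextP, next, stepP_self]

variable {s} in
/-- **The padded update is computed on codes**, for any string selector `g ∈ FP` and any size
bound computed on codes from unary inputs. [cite: AroraBarak2009, §1.3] -/
theorem cf_updateP (hsC : CodeFP unE natE s) {g : List Bool → List Bool} (hg : g ∈ FP) :
    CodeFP (pairE unE (pairE natE (pairE strE bitE))) strE
      (fun v => updateP s g v.1 v.2.1 v.2.2.1 v.2.2.2) := by
  have hP : CodeFP (pairE unE (pairE natE (pairE strE bitE))) unE (fun v => v.1) := CodeFP.fst _ _
  have hN : CodeFP (pairE unE (pairE natE (pairE strE bitE))) natE (fun v => v.2.1) :=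
    (CodeFP.snd _ _).fst'
  have hσ : CodeFP (pairE unE (pairE natE (pairE strE bitE))) strE (fun v => v.2.2.1) :=
    (CodeFP.snd _ _).snd'.fst'
  have hb : CodeFP (pairE unE (pairE natE (pairE strE bitE))) bitE (fun v => v.2.2.2) :=
    (CodeFP.snd _ _).snd'.snd'
  have hT : CodeFP (pairE unE (pairE natE (pairE strE bitE))) (pairE natE (pairE bitE strE))
      (fun v => parse v.2.2.1) := cf_parse.comp hσ
  have hInst : CodeFP (pairE unE (pairE natE (pairE strE bitE))) instE
      (fun v => (v.1, v.2.1, (parse v.2.2.1).1, (parse v.2.2.1).2.2, v.2.2.2)) :=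
    hP.pair (hN.pair (hT.fst'.pair (hT.snd'.snd'.pair hb)))
  have hG : CodeFP instE strE (fun i => g (instE i)) := CodeFP.of_fn g hg fun _ => rfl
  have hSel : CodeFP (pairE unE (pairE natE (pairE strE bitE))) strE
      (fun v => selOf g v.1 v.2.1 (parse v.2.2.1).1 (parse v.2.2.1).2.2 v.2.2.2) :=
    (hG.comp hInst).congr fun _ => rfl
  have hGood : CodeFP (pairE unE (pairE natE (pairE strE bitE))) bitE
      (fun v => GoodP s v.1 v.2.1 (parse v.2.2.1).1 (parse v.2.2.1).2.2 v.2.2.2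
        (selOf g v.1 v.2.1 (parse v.2.2.1).1 (parse v.2.2.1).2.2 v.2.2.2)) :=
    ((cf_goodP hsC).comp (hInst.pair hSel)).congr fun _ => rfl
  have hCond : CodeFP (pairE unE (pairE natE (pairE strE bitE))) bitE
      (fun v => (parse v.2.2.1).2.1 && GoodP s v.1 v.2.1 (parse v.2.2.1).1 (parse v.2.2.1).2.2
        v.2.2.2 (selOf g v.1 v.2.1 (parse v.2.2.1).1 (parse v.2.2.1).2.2 v.2.2.2)) :=
    hT.snd'.fst'.and hGood
  have hj1 : CodeFP (pairE unE (pairE natE (pairE strE bitE))) natE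
      (fun v => (parse v.2.2.1).1 + 1) :=
    CodeFP.natAdd.comp (hT.fst'.pair (CodeFP.const _ 1))
  -- (no type ascriptions on the next two: an expected type here makes the unifier unfold
  -- `encSt`/`encodeNat` while approximating a higher-order pattern, which times out)
  have hYes := cf_encSt.comp (hj1.pair ((CodeFP.const _ true).pair hSel))
  have hNo := cf_encSt.comp (hj1.pair ((CodeFP.const _ false).pair
    (CodeFP.const (pairE unE (pairE natE (pairE strE bitE))) ([] : List Bool))))
  refine (hCond.ite hYes hNo).congr fun v => ?_
  dsimp only
  simp only [updateP, nextP, stepP]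
  split_ifs <;> rfl

/-- **The accepting predicate is computed on codes.** [folklore] -/
theorem cf_accept : CodeFP (pairE natE strE) bitE (fun p => accept p.1 p.2) :=
  ((CodeFP.natEq.comp ((CodeFP.fst _ _).pair (CodeFP.natPow.comp ((CodeFP.const _ 2).pair
    (cf_log.comp (CodeFP.fst _ _)))))).and (cf_decA.comp (CodeFP.snd _ _))).congr fun _ => rfl

/-! ### The three stages of the padded update machine, on codes

The update machine of Layer 3 receives `u = ⟨bin N, σ, b⟩`, rewrites it as the loop word
`⟨flag, 1^i, u⟩` with `i = 0`, counts `i` up to `N` (the flag, the word's first symbol, turns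
`true` exactly when `i ≥ N`), and then runs the padded update with `P = i = N`. -/

/-- Update inputs `⟨bin N, σ, b⟩`. [folklore] -/
abbrev UIn : Type := ℕ × List Bool × Bool

/-- Their code `boolPair (bin N) (boolPair σ [b])`. [folklore] -/
abbrev uE : UIn → List Bool := pairE natE (pairE strE bitE)

/-- Loop words `⟨flag, 1^i, u⟩`. [folklore] -/
abbrev W : Type := Bool × ℕ × UIn

/-- Their code. [folklore] -/
abbrev wE : W → List Bool := pairE bitE (pairE unE uE)

/-- Stage 1: `u ↦ ⟨false, 1^0, u⟩`. [folklore] -/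
theorem cf_padInit : CodeFP uE wE (fun u => (false, 0, u)) :=
  ((CodeFP.const _ false).pair ((CodeFP.const _ (0 : ℕ)).pair (CodeFP.id _))).congr fun _ => rfl

/-- Stage 2 (loop body): `⟨_, 1^i, u⟩ ↦ ⟨[N ≤ i + 1], 1^{i+1}, u⟩`. [folklore] -/
theorem cf_padStep : CodeFP wE wE (fun w => (decide (w.2.2.1 ≤ w.2.1 + 1), w.2.1 + 1, w.2.2)) := by
  have hi : CodeFP wE unE (fun w => w.2.1 + 1) := CodeFP.unSucc.comp (CodeFP.snd _ _).fst'
  have hN : CodeFP wE natE (fun w => w.2.2.1) := (CodeFP.snd _ _).snd'.fst'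
  exact (CodeFP.natLeUn.comp (hN.pair hi)).pair (hi.pair (CodeFP.snd _ _).snd')

variable {s} in
/-- Stage 3: `⟨_, 1^P, bin N, σ, b⟩ ↦ updateP s g P N σ b`. [folklore] -/
theorem cf_padCore (hsC : CodeFP unE natE s) {g : List Bool → List Bool} (hg : g ∈ FP) :
    CodeFP wE strE (fun w => updateP s g w.2.1 w.2.2.1 w.2.2.2.1 w.2.2.2.2) :=
  (cf_updateP hsC hg).comp (CodeFP.snd _ _)

end CStream

end Summit.PneNP.PneNP.Theorems.SoloBlind
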